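import Literature.NumberTheory.EllipticCurves.BSDRankLeOneDensityFiveSelmer
import Literature.NumberTheory.EllipticCurves.SelmerCountShaTorsionProofs
import Literature.NumberTheory.EllipticCurves.TwoIsogenyShaTwoTorsion
import Literature.NumberTheory.EllipticCurves.BhargavaSkinnerZhang2014.CellUnion
import Literature.NumberTheory.EllipticCurves.LeadingTerm
import Literature.NumberTheory.EllipticCurves.BSDSelmerParityDokchitserProofs
import Literature.NumberTheory.EllipticCurves.SelmerCorankHolds

/-!
# BirchSwinnertonDyer / ShaPrimaryTransfer — crux `OneFiniteShaComponent` (stmt-BirchSwinnertonDyer-22357):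
# the door at 5 is open for at least 20.62% of elliptic curves, by descent alone (Bhargava–Shankar's inputs)

Route `ShaPrimaryTransfer` (D-0145 LINE 2): O = `OneFiniteShaComponent` (every elliptic `E/ℚ` has SOME prime `p₀`
with `t_{p₀}(E) = corank_{ℤ_{p₀}} Ш(E)[p₀^∞] = 0`), to be decided by DESCENT with no Iwasawa theory, no `p`-adic
`L`-function and no Heegner point. The companion file `…OneFiniteShaComponentKernelDoors` certifies doors curve by
curve (ranks 0, 1, 2). This helper file (prover seat `bsd-line-spt-p1`, `--supports stmt-22357 --as helper`;
ROUTE-INDEPENDENT, no `Theses` import) gives the CLASS-WIDE, quantitative form of the same instrument: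

**At least `20.62%` of elliptic curves over `ℚ`, ordered by naive height, have `rank E(ℚ) = 0` AND `Ш(E/ℚ)[5] = 0` —
hence `t_5(E) = 0`, the door at `5`, and the body of O** — modulo exactly the three printed inputs of
Bhargava–Shankar's Theorem 5 (arXiv:1312.7859) as the tree keys them in `BSDRankLeOneDensityFiveSelmer`:
`h31` (Thm 31: the average of `#Sel^(5)` over every large congruence family is `≤ 6`), `h6` (Thm 6 with §5: a
disjoint union `U` of large families of lower density `≥ .5501`, stable under `E ↦ E₋₁` with `w(E₋₁) = -w(E)`), `hDD`
(Thm 39 = Dokchitser–Dokchitser parity in the `5`-Selmer form `even_selmerRank_sub_torsionRank_iff`). No main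
conjecture, no Gross–Zagier–Kolyvagin: a `5`-descent count.

The point. The tree's version of Thm 5 (`heightDensityGE_rankZero_of_five_selmer_of_inputs`) concludes `rank = 0`
for `≥ 20.62%`; its per-curve engine `le_twentyfour_mul_ite_rank_eq_zero_of_parity` («`15 - #Sel^(5) + 10·w ≤
24·[rank = 0]`») fires exactly when `m = s₅ − t₅ = 0`, i.e. `#Sel^(5)(E) = #E(ℚ)[5]` — an EXACT `5`-descent count,
which by the tree's proved descent count `#Sel^(n) = n^{rank}·#E(K)[n]·#Ш[n]` (`natCard_selmerGroup_eq`, Silverman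
X.4.2) also kills `Ш(E)[5]` (`sha_torsion_eq_zero_of_natCard_selmerGroup_eq'`). So the same linear programme gives
the sharper per-curve inequality `15 - #Sel^(5) + 10·w ≤ 24·[rank = 0 ∧ t_5 = 0]` (`le_twentyfour_mul_ite_door_five_of_parity`),
the same finite-height count (`le_card_door_five`), and the same density `3κ/8` (`heightDensityGE_door_five_of_five_selmer_family`),
`κ = .5501 ↦ .2062` (`heightDensityGE_door_five_of_inputs`); in O's shape: `heightDensityGE_oneFiniteShaComponent_of_inputs`.
For comparison, the KERNEL `T ∧ O` per curve (every `t_q(E) = 0`, i.e. `Ш(E/ℚ)[q^∞]` finite for all `q`) holds for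
`≥ 66.48%` (printed; `65.97%` as established, see the tree's caveat on `bhargava_skinner_zhang`) modulo
Bhargava–Skinner–Zhang — whose inputs include the Skinner–Urban main conjecture and Gross–Zagier–Kolyvagin
(`heightDensityGE_forall_shaCorank_eq_zero_of_BSZ`). The gap `20.62% (descent) < 66% (Iwasawa + GZK) < 100% (O)`
is the class-wide price of the route's «door by descent».

Nothing here proves O, T or BSD. References: M. Bhargava, A. Shankar, arXiv:1312.7859 (2013), Thms 5, 6, 31, 39,
Prop 40(c); M. Bhargava, C. Skinner, W. Zhang, arXiv:1407.1826 (2014), Thms 1–2; T. and V. Dokchitser, Ann. of Math.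
172 (2010), Thm 1.4; J. H. Silverman, *AEC* 2nd ed., Thm X.4.2; R. Greenberg, LNM 1716 (1999), §1.
-/

-- D-0017: single-problem summit, so `Summit.BirchSwinnertonDyer.BirchSwinnertonDyer.…` repeats a namespace BY DESIGN.
set_option linter.dupNamespace false

noncomputable section

namespace Summit.BirchSwinnertonDyer.BirchSwinnertonDyer.Theorems.ShaPrimaryTransferDoorDensity

open scoped Classical
open scoped AddSubgroup
open Filter Topology WeierstrassCurve
open Literature.NumberTheory.EllipticCurves

/-! ## §1 Per curve: an exact `5`-descent count is a door at 5 -/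

/-- **`Ш(E/ℚ)[p] = 0 ⟹ t_p(E) = 0`**, bridging the certificate shape `∀ x : Ш, (p : ℤ) • x = 0 → x = 0` of the
tree's descent-count lemmas to `WeierstrassCurve.shaCorank_eq_zero_of_forall`. [cite: Greenberg1999LNM, §1 pp. 54–57] -/
theorem shaCorank_eq_zero_of_sha_torsion_eq_zero (W : WeierstrassCurve ℚ) (p : ℕ) [Fact p.Prime]
    (h : ∀ x : W.sha, (p : ℤ) • x = 0 → x = 0) : W.shaCorank p = 0 := by
  refine W.shaCorank_eq_zero_of_forall p fun c hc hpc ↦ ?_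
  have h0 := h ⟨c, hc⟩ (Subtype.ext (by
    rw [AddSubgroupClass.coe_zsmul, ZeroMemClass.coe_zero, natCast_zsmul]; exact hpc))
  exact congrArg Subtype.val h0

/-- **An exact `5`-descent count in rank 0 is a door at 5**: if `#Sel^(5)(E/ℚ) = #E(ℚ)[5]` then `rank E(ℚ) = 0`
(descent inequality `5^{rank}·#E(ℚ)[5] ≤ #Sel^(5)`) and `Ш(E/ℚ)[5] = 0` (exact descent count, tree
`natCard_selmerGroup_eq`), so `t_5(E) = 0`. UNCONDITIONAL. [cite: SilvermanAEC2009, Thm X.4.2] -/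
theorem rank_eq_zero_and_shaCorank_five_eq_zero_of_natCard_selmerGroup_eq (W : WeierstrassCurve ℚ) [W.IsElliptic]
    (h : Nat.card (W.selmerGroup 5) = Nat.card (W.toAffine.Point[((5 : ℕ) : ℤ)])) :
    W.mordellWeilRank = 0 ∧ W.shaCorank 5 = 0 := by
  haveI : Fact (Nat.Prime 5) := ⟨by norm_num⟩
  have hineq := pow_mordellWeilRank_mul_card_torsionBy_le_rat W 5
  obtain ⟨t, ht⟩ := exists_natCard_torsionBy_eq_pow_rat W 5
  simp only [Nat.cast_ofNat] at hineq ht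
  rw [h, ht] at hineq
  have hr : W.mordellWeilRank = 0 := by
    by_contra hr
    have h5 : 5 ≤ 5 ^ W.mordellWeilRank := by
      calc 5 = 5 ^ 1 := (pow_one 5).symm
        _ ≤ 5 ^ W.mordellWeilRank := Nat.pow_le_pow_right (by norm_num) (by omega)
    have hpos : 0 < 5 ^ t := pow_pos (by norm_num) t
    nlinarith
  refine ⟨hr, shaCorank_eq_zero_of_sha_torsion_eq_zero W 5 ?_⟩
  refine W.sha_torsion_eq_zero_of_natCard_selmerGroup_eq' (n := 5) (by norm_num) ?_
  rw [hr, pow_zero, one_mul]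
  simpa only [Nat.cast_ofNat] using h

/-- **Prop 40(c) pointwise, door form** (with Thm 39, `hDD`): for every elliptic `E/ℚ`,
`15 - #Sel^(5)(E/ℚ) + 10·w(E) ≤ 24·[rank E(ℚ) = 0 ∧ t_5(E) = 0]`. With `#Sel^(5) = 5^s`, `#E(ℚ)[5] = 5^t`,
`rank + t ≤ s` and `s - t` even iff `w = +1`: if `w = +1`, either `s = t` (exact count: rank `0` AND `Ш[5] = 0`, and
`25 - 5^s ≤ 24`) or `s ≥ t + 2` (`#Sel^(5) ≥ 25`); if `w = -1`, `s ≥ t + 1` and `#Sel^(5) ≥ 5`. The tree's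
`le_twentyfour_mul_ite_rank_eq_zero_of_parity` is the same inequality with the weaker indicator `[rank = 0]`.
[cite: BhargavaShankar5Selmer2013, Prop 40(c) (proof) and Thm 39] [cite: SilvermanAEC2009, Thm X.4.2] -/
theorem le_twentyfour_mul_ite_door_five_of_parity (hDD : even_selmerRank_sub_torsionRank_iff)
    (W : WeierstrassCurve ℚ) [W.IsElliptic] :
    15 - (Nat.card (W.selmerGroup 5) : ℝ) + 10 * (W.rootNumber : ℝ) ≤
      24 * (if W.mordellWeilRank = 0 ∧ W.shaCorank 5 = 0 then (1 : ℝ) else 0) := by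
  haveI : Fact (Nat.Prime 5) := ⟨by norm_num⟩
  obtain ⟨s, hs⟩ := exists_natCard_selmerGroup_eq_pow W 5
  obtain ⟨t, ht⟩ := exists_natCard_torsionBy_eq_pow_rat W 5
  have hpar := hDD W 5 s t hs ht
  have hineq := pow_mordellWeilRank_mul_card_torsionBy_le_rat W 5
  rw [ht, hs, ← pow_add] at hineq
  have hle : W.mordellWeilRank + t ≤ s := (Nat.pow_le_pow_iff_right (by norm_num)).mp hineq
  have hind : (0 : ℝ) ≤ (if W.mordellWeilRank = 0 ∧ W.shaCorank 5 = 0 then (1 : ℝ) else 0) := by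
    split_ifs <;> norm_num
  have hSelR : (Nat.card (W.selmerGroup 5) : ℝ) = (5 : ℝ) ^ s := by exact_mod_cast hs
  rw [hSelR]
  rcases W.rootNumber_eq_one_or with hw | hw
  · rw [hw]
    push_cast
    by_cases hst : s = t
    · -- exact `5`-descent count: the door
      have hcount : Nat.card (W.selmerGroup 5) = Nat.card (W.toAffine.Point[((5 : ℕ) : ℤ)]) := by
        simp only [Nat.cast_ofNat] at hs
        rw [hs, ht, hst]
      rw [if_pos (rank_eq_zero_and_shaCorank_five_eq_zero_of_natCard_selmerGroup_eq W hcount)]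
      have h1 : (1 : ℝ) ≤ (5 : ℝ) ^ s := one_le_pow₀ (by norm_num)
      linarith
    · have hev : Even ((s : ℤ) - t) := hpar.mpr hw
      have h2 : t + 2 ≤ s := by
        obtain ⟨k, hk⟩ := hev
        omega
      have h25 : (5 : ℝ) ^ 2 ≤ (5 : ℝ) ^ s := pow_le_pow_right₀ (by norm_num : (1 : ℝ) ≤ 5) (by omega)
      norm_num at h25
      linarith
  · have h1 : 1 ≤ s := by
      by_contra h0
      have hs0 : s = 0 := by omega
      have ht0 : t = 0 := by omega
      have hev : Even ((s : ℤ) - t) := by rw [hs0, ht0]; exact ⟨0, by norm_num⟩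
      have := hpar.mp hev
      rw [hw] at this
      norm_num at this
    rw [hw]
    push_cast
    have h5 : (5 : ℝ) ^ 1 ≤ (5 : ℝ) ^ s := pow_le_pow_right₀ (by norm_num : (1 : ℝ) ≤ 5) h1
    norm_num at h5
    linarith

/-! ## §2 The count at a finite height and the density `3κ/8` -/

/-- **The count behind the door density at a finite height `X`** (door form of the tree's `le_card_rank_eq_zero`): for
`U` stable under `E ↦ E₋₁` with `w(E₋₁) = -w(E)` on `U`, granting Thm 39,
`15·#{U, H < X} - ∑_{U, H < X} #Sel^(5) ≤ 24·#{H < X : rank = 0 ∧ t_5 = 0}`.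
[cite: BhargavaShankar5Selmer2013, §6 (proof of Thm 5: Prop 40(c))] -/
theorem le_card_door_five (hDD : even_selmerRank_sub_torsionRank_iff) (U : ℤ × ℤ → Prop)
    (hU : ∀ AB, U AB → U (negB AB))
    (hflip : ∀ AB, U AB → (shortWeierstrass (negB AB)).rootNumber = -(shortWeierstrass AB).rootNumber) (X : ℕ) :
    15 * (((heightFamilyBelow X).filter U).card : ℝ) -
        ∑ AB ∈ (heightFamilyBelow X).filter U, (Nat.card ((shortWeierstrass AB).selmerGroup 5) : ℝ) ≤
      24 * (((heightFamilyBelow X).filter (fun AB ↦ (shortWeierstrass AB).mordellWeilRank = 0 ∧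
        (shortWeierstrass AB).shaCorank 5 = 0)).card : ℝ) := by
  have hell : ∀ AB ∈ heightFamilyBelow X, (shortWeierstrass AB).IsElliptic :=
    fun AB hAB ↦ isElliptic_shortWeierstrass ((mem_heightFamilyBelow_iff AB X).mp hAB).1
  rw [Finset.natCast_card_filter
    (fun AB ↦ (shortWeierstrass AB).mordellWeilRank = 0 ∧ (shortWeierstrass AB).shaCorank 5 = 0)]
  have hUsum : ∑ AB ∈ (heightFamilyBelow X).filter U,
      (15 - (Nat.card ((shortWeierstrass AB).selmerGroup 5) : ℝ) + 10 * ((shortWeierstrass AB).rootNumber : ℝ)) ≤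
      24 * ∑ AB ∈ (heightFamilyBelow X).filter U,
        (if (shortWeierstrass AB).mordellWeilRank = 0 ∧ (shortWeierstrass AB).shaCorank 5 = 0
          then (1 : ℝ) else 0) := by
    have h := Finset.sum_le_sum (s := (heightFamilyBelow X).filter U)
      (f := fun AB ↦ 15 - (Nat.card ((shortWeierstrass AB).selmerGroup 5) : ℝ) +
        10 * ((shortWeierstrass AB).rootNumber : ℝ))
      (g := fun AB ↦ 24 * (if (shortWeierstrass AB).mordellWeilRank = 0 ∧ (shortWeierstrass AB).shaCorank 5 = 0
        then (1 : ℝ) else 0))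
      fun AB hAB ↦ by
        haveI := hell AB (Finset.mem_filter.mp hAB).1
        exact le_twentyfour_mul_ite_door_five_of_parity hDD (shortWeierstrass AB)
    rwa [← Finset.mul_sum] at h
  have hLHS : ∑ AB ∈ (heightFamilyBelow X).filter U,
      (15 - (Nat.card ((shortWeierstrass AB).selmerGroup 5) : ℝ) + 10 * ((shortWeierstrass AB).rootNumber : ℝ)) =
      15 * (((heightFamilyBelow X).filter U).card : ℝ) -
        ∑ AB ∈ (heightFamilyBelow X).filter U, (Nat.card ((shortWeierstrass AB).selmerGroup 5) : ℝ) := by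
    rw [Finset.sum_add_distrib, Finset.sum_sub_distrib, ← Finset.mul_sum,
      sum_rootNumber_eq_zero U hU hflip X, Finset.sum_const, nsmul_eq_mul]
    ring
  have hmono : ∑ AB ∈ (heightFamilyBelow X).filter U,
      (if (shortWeierstrass AB).mordellWeilRank = 0 ∧ (shortWeierstrass AB).shaCorank 5 = 0 then (1 : ℝ) else 0) ≤
      ∑ AB ∈ heightFamilyBelow X,
        (if (shortWeierstrass AB).mordellWeilRank = 0 ∧ (shortWeierstrass AB).shaCorank 5 = 0 then (1 : ℝ) else 0) :=
    Finset.sum_le_sum_of_subset_of_nonneg (Finset.filter_subset _ _) fun _ _ _ ↦ by split_ifs <;> norm_num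
  linarith

/-- **The door density for a general root-number family** (door form of the tree's
`heightDensityGE_rankZero_of_five_selmer_family`): under Thm 31 on the pieces of `U` (`h31`), a root-number family
`U` of lower density `κ` (`hF`) and Thm 39 (`hDD`), at least a proportion `3κ/8` of elliptic curves over `ℚ`, ordered
by naive height, have `rank E(ℚ) = 0` and `t_5(E) = 0`. [cite: BhargavaShankar5Selmer2013, §6 (proof of Thm 5) with Prop 40(c)] -/
theorem heightDensityGE_door_five_of_five_selmer_family {κ : ℝ}
    (h31 : ∀ F : CongruenceFamily, F.IsLarge → ∀ ε : ℝ, 0 < ε → ∀ᶠ X : ℕ in atTop,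
      heightAverageOn F.Mem (fun AB ↦ (Nat.card ((shortWeierstrass AB).selmerGroup 5) : ℝ)) X ≤ 6 + ε)
    (hF : ∃ (n : ℕ) (F : Fin n → CongruenceFamily), (∀ i, (F i).IsLarge) ∧
      (∀ i j, i ≠ j → ∀ AB, (F i).Mem AB → ¬ (F j).Mem AB) ∧
      (∀ AB, UnionMem F AB → UnionMem F (AB.1, -AB.2)) ∧
      (∀ AB, UnionMem F AB → (shortWeierstrass (AB.1, -AB.2)).rootNumber = -(shortWeierstrass AB).rootNumber) ∧
      HeightDensityGE (UnionMem F) κ)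
    (hDD : even_selmerRank_sub_torsionRank_iff) :
    HeightDensityGE (fun AB ↦ (shortWeierstrass AB).mordellWeilRank = 0 ∧ (shortWeierstrass AB).shaCorank 5 = 0)
      (3 * κ / 8) := by
  obtain ⟨n, F, hlarge, hdisj, htwist, hflip, hdens⟩ := hF
  intro ε hε
  have e1 := eventually_sum_le_of_heightAverageOn_le (fun i ↦ (F i).Mem) hdisj (UnionMem F)
    (fun _ ↦ Iff.rfl) (fun AB ↦ (Nat.card ((shortWeierstrass AB).selmerGroup 5) : ℝ))
    (fun i ↦ h31 (F i) (hlarge i) (6 * ε) (by positivity))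
  have e3 := hdens (2 * ε) (by positivity)
  filter_upwards [e1, e3, eventually_ge_atTop 28] with X hX1 hX3 hX28
  have hpos : 0 < (heightFamilyBelow X).card := Finset.card_pos.mpr ⟨_, zeroOne_mem_heightFamilyBelow hX28⟩
  have hN : (0 : ℝ) < (heightFamilyBelow X).card := by exact_mod_cast hpos
  rw [heightProportion_eq_card_div, le_div_iff₀ hN] at hX3
  rw [heightProportion_eq_card_div, le_div_iff₀ hN]
  have hcount := le_card_door_five hDD (UnionMem F) (fun AB h ↦ htwist AB h) (fun AB h ↦ hflip AB h) X
  have hUle : (((heightFamilyBelow X).filter (UnionMem F)).card : ℝ) ≤ (heightFamilyBelow X).card := by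
    exact_mod_cast Finset.card_le_card (Finset.filter_subset _ _)
  have hεU : ε * (((heightFamilyBelow X).filter (UnionMem F)).card : ℝ) ≤ ε * (heightFamilyBelow X).card :=
    mul_le_mul_of_nonneg_left hUle hε.le
  linarith [hcount, hX1, hX3, hεU]

/-! ## §3 Theorem 5 of Bhargava–Shankar, door form: `20.62%` -/

/-- **At least `20.62%` of elliptic curves over `ℚ`, ordered by naive height, have `rank E(ℚ) = 0` and `t_5(E) = 0`
(indeed `Ш(E/ℚ)[5] = 0`)**, modulo LITERALLY the three hypotheses `h31`, `h6`, `hDD` of the tree's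
`heightDensityGE_rankZero_of_five_selmer_of_inputs` (Bhargava–Shankar Thm 31, Thm 6 with §5, Thm 39): the door at 5,
class-wide, by a `5`-descent count — no Iwasawa theory, no Gross–Zagier–Kolyvagin.
[cite: BhargavaShankar5Selmer2013, Thm 5 and §6 (with Thm 31, Thm 6, Thm 39, Prop 40(c))] -/
theorem heightDensityGE_door_five_of_inputs
    (h31 : ∀ F : CongruenceFamily, F.IsLarge → ∀ ε : ℝ, 0 < ε → ∀ᶠ X : ℕ in atTop,
      heightAverageOn F.Mem (fun AB ↦ (Nat.card ((shortWeierstrass AB).selmerGroup 5) : ℝ)) X ≤ 6 + ε)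
    (h6 : ∃ (n : ℕ) (F : Fin n → CongruenceFamily), (∀ i, (F i).IsLarge) ∧
      (∀ i j, i ≠ j → ∀ AB, (F i).Mem AB → ¬ (F j).Mem AB) ∧
      (∀ AB, UnionMem F AB → UnionMem F (AB.1, -AB.2)) ∧
      (∀ AB, UnionMem F AB → (shortWeierstrass (AB.1, -AB.2)).rootNumber = -(shortWeierstrass AB).rootNumber) ∧
      HeightDensityGE (UnionMem F) 0.5501)
    (hDD : even_selmerRank_sub_torsionRank_iff) :
    HeightDensityGE (fun AB ↦ (shortWeierstrass AB).mordellWeilRank = 0 ∧ (shortWeierstrass AB).shaCorank 5 = 0)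
      0.2062 := by
  have h := heightDensityGE_door_five_of_five_selmer_family h31 h6 hDD
  intro ε hε
  filter_upwards [h ε hε] with X hX
  norm_num at hX ⊢
  linarith

/-- **O holds for at least `20.62%` of elliptic curves over `ℚ`** (the body of `OneFiniteShaComponent`, witness prime
`5`), modulo Bhargava–Shankar's three inputs `h31`, `h6`, `hDD`. [cite: BhargavaShankar5Selmer2013, Thm 5] -/
theorem heightDensityGE_oneFiniteShaComponent_of_inputs
    (h31 : ∀ F : CongruenceFamily, F.IsLarge → ∀ ε : ℝ, 0 < ε → ∀ᶠ X : ℕ in atTop,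
      heightAverageOn F.Mem (fun AB ↦ (Nat.card ((shortWeierstrass AB).selmerGroup 5) : ℝ)) X ≤ 6 + ε)
    (h6 : ∃ (n : ℕ) (F : Fin n → CongruenceFamily), (∀ i, (F i).IsLarge) ∧
      (∀ i j, i ≠ j → ∀ AB, (F i).Mem AB → ¬ (F j).Mem AB) ∧
      (∀ AB, UnionMem F AB → UnionMem F (AB.1, -AB.2)) ∧
      (∀ AB, UnionMem F AB → (shortWeierstrass (AB.1, -AB.2)).rootNumber = -(shortWeierstrass AB).rootNumber) ∧
      HeightDensityGE (UnionMem F) 0.5501)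
    (hDD : even_selmerRank_sub_torsionRank_iff) :
    HeightDensityGE (fun AB ↦ ∃ (p : ℕ) (_ : Fact p.Prime), (shortWeierstrass AB).shaCorank p = 0) 0.2062 :=
  BhargavaSkinnerZhang2014.HeightDensityGE.mono (fun _ h ↦ ⟨5, ⟨by norm_num⟩, h.2⟩)
    (heightDensityGE_door_five_of_inputs h31 h6 hDD)

/-! ## §4 For comparison: the kernel `T ∧ O` per curve for ≥ 66% modulo Bhargava–Skinner–Zhang -/

/-- **Every `t_q(E) = 0` for at least `66.48%` of elliptic curves over `ℚ`** (printed constant; `65.97%` as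
established, `bhargava_skinner_zhang.corrected_constant`), modulo the named fact `bhargava_skinner_zhang` (bsd.S27:
`rank = ord_{s=1} L ≤ 1` and `Ш` finite for that proportion; its inputs include the Skinner–Urban main conjecture and
Gross–Zagier–Kolyvagin): a finite `Ш` has every primary corank `0`. This is the per-curve KERNEL `T ∧ O` (X1 at every
prime) in density form. CONDITIONAL on `hBSZ`. [cite: arXiv14071826, Thms 1–2] [cite: Greenberg1999LNM, §1 pp. 54–57] -/
theorem heightDensityGE_forall_shaCorank_eq_zero_of_BSZ (hBSZ : bhargava_skinner_zhang) :
    HeightDensityGE (fun AB ↦ ∀ (q : ℕ) [Fact q.Prime], (shortWeierstrass AB).shaCorank q = 0) 0.6648 := by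
  refine BhargavaSkinnerZhang2014.HeightDensityGE.mono (fun AB h q hq ↦ ?_) hBSZ
  haveI := hq
  haveI : Finite (shortWeierstrass AB).sha := h.2.2.2
  exact (shortWeierstrass AB).shaCorank_eq_zero_of_finite q

/-- The same with the constant `0.6597` that the printed argument establishes. CONDITIONAL on `hBSZ`.
[cite: arXiv14071826, Cor 26 (constant corrected)] -/
theorem heightDensityGE_forall_shaCorank_eq_zero_of_BSZ_corrected (hBSZ : bhargava_skinner_zhang) :
    HeightDensityGE (fun AB ↦ ∀ (q : ℕ) [Fact q.Prime], (shortWeierstrass AB).shaCorank q = 0) 0.6597 := by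
  refine BhargavaSkinnerZhang2014.HeightDensityGE.mono (fun AB h q hq ↦ ?_) hBSZ.corrected_constant
  haveI := hq
  haveI : Finite (shortWeierstrass AB).sha := h.2.2.2
  exact (shortWeierstrass AB).shaCorank_eq_zero_of_finite q

end Summit.BirchSwinnertonDyer.BirchSwinnertonDyer.Theorems.ShaPrimaryTransferDoorDensity
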